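import Literature.Topology.FourManifolds.LefschetzBasePages
import Literature.Topology.FourManifolds.TorusKnotMilnorFibreHomology
import HarnessLib

/-!
# The standard Lefschetz base of genus `g`, IV: the Milnor cover `Base g = U ∪ V`; the piece `U`

Topic `Literature/Topology/FourManifolds`; namespace `Literature.Topology.FourManifolds.LefschetzBase`.
Fourth vocabulary file of the concrete base `Base g = {‖y² − x^{2g+1} − 1‖² + eta ‖x‖² ≤ 1/4} ⊂ ℂ²`
(`LefschetzBaseModel.lean`, `LefschetzBaseRegular.lean`, `LefschetzBasePages.lean`); first file of
the computation of `H₁(Base g; ℤ)` (Milnor 1968, Thm. 9.1 for the `A_{2g}` fibre — the debt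
`exists_isChainShadow` behind `shadowMap`).  Everything here is PROVED; nothing is asserted.

Milnor's Theorem 9.1 deformation retracts the fibre `y² = 1 + x^{2g+1}` onto the join of the roots
of `y² = 1` and `x^{2g+1} = −1` (Lemma 9.2, Pham).  As in the tree's treatment of the torus-knot
fibre (`TorusKnotMilnorFibreHomology.lean`) the join is replaced by a Mayer–Vietoris cover adapted
to the half-planes of `x^{2g+1}`, here for the THICKENED fibre `Base g`: the thickening parameter
`w = y² − x^{2g+1} − 1` (`‖w‖ ≤ 1/2`) is carried along linearly, and `rho = ‖w‖² + eta ‖x‖²` is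
controlled through `eta` being monotone and zero on `‖x‖ ≤ 2` (`mk_mem_base`).

* §8 the open cover `coverU g = {Re x^{2g+1} > −3/8}`, `coverV g = {Re x^{2g+1} < −1/4}` of
  `Base g` (`isOpen_coverU`, `isOpen_coverV`, `coverU_union_coverV`) and the bookkeeping lemma
  `mk_mem_base`: a point `(a', b')` with `b'² − a'^{2g+1} − 1 = t·w(p)`, `0 ≤ t ≤ 1`, and
  `‖a'‖^{2g+1} ≤ max 1 ‖x(p)‖^{2g+1}` lies in the base whenever `p` does;
* §9 on `U`, `Re y² > 1/8`; the sheet sign `angU = y / √(y²) ∈ {±1}` is locally constant, and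
  `(x, y) ↦ (t x, angU · √((tx)^{2g+1} + 1 + t w))` deformation retracts `U` onto the two points
  `(0, ±1)`: **`homotopyEquivU : U ≃ₕ Fin 2`** (index map `idxU`, section `secU`).

Sequels: `LefschetzBaseCoverSectors.lean` (`V ≃ₕ Fin (2g+1)`, the sectors of the branch points),
`LefschetzBaseCoverOverlap.lean` (`U ∩ V ≃ₕ Fin 2 × Fin (2g+1)`); then the end of the
Mayer–Vietoris sequence (`MayerVietorisBettiOne.lean`) gives `H₁(Base g; ℤ)` free of rank
`2(2g+1) − 2 − (2g+1) + 1 = 2g`.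

## References
* J. Milnor, *Singular points of complex hypersurfaces*, Ann. of Math. Studies 61 (1968), §9,
  Thm. 9.1, Lemma 9.2. [Milnor1968]
* A. Hatcher, *Algebraic Topology*, CUP 2002, §2.2 pp. 149–150 (Mayer–Vietoris). [HatcherAT2002]
-/

noncomputable section

open scoped Manifold ContDiff Topology
open Set Function Metric
open Literature.Topology.FourManifolds.TorusKnotMilnor

namespace Literature.Topology.FourManifolds

/-- Local notation: `𝔼 n` is the model Euclidean space `EuclideanSpace ℝ (Fin n)`. -/
local notation "𝔼 " n:arg => EuclideanSpace ℝ (Fin n)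

namespace LefschetzBase

/-! ## §8 The cover `Base g = U ∪ V` by half-planes of `x^{2g+1}` -/

variable {g : ℕ}

/-- `x^{2g+1}` is continuous on the base. [folklore] -/
theorem continuous_xPow (g : ℕ) : Continuous fun p : Base g => cx p.1 ^ (2 * g + 1) :=
  (contDiff_cx.continuous.comp continuous_subtype_val).pow _

/-- **The piece `U = {Re x^{2g+1} > −3/8}`** of the base (the two `y`-sheets). [cite: Milnor1968, §9 Lemma 9.2] -/
def coverU (g : ℕ) : Set (Base g) := {p | -(3 / 8 : ℝ) < (cx p.1 ^ (2 * g + 1)).re}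

/-- **The piece `V = {Re x^{2g+1} < −1/4}`** of the base (the `2g+1` sectors of the branch
points). [cite: Milnor1968, §9 Lemma 9.2] -/
def coverV (g : ℕ) : Set (Base g) := {p | (cx p.1 ^ (2 * g + 1)).re < -(1 / 4 : ℝ)}

/-- `U` is open. [folklore] -/
theorem isOpen_coverU (g : ℕ) : IsOpen (coverU g) :=
  isOpen_lt continuous_const (Complex.continuous_re.comp (continuous_xPow g))

/-- `V` is open. [folklore] -/
theorem isOpen_coverV (g : ℕ) : IsOpen (coverV g) :=
  isOpen_lt (Complex.continuous_re.comp (continuous_xPow g)) continuous_const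

/-- `U ∪ V` is the whole base. [folklore] -/
theorem coverU_union_coverV (g : ℕ) : coverU g ∪ coverV g = univ :=
  eq_univ_of_forall fun p => by
    by_cases h : -(3 / 8 : ℝ) < (cx p.1 ^ (2 * g + 1)).re
    · exact Or.inl h
    · exact Or.inr (by change (cx p.1 ^ (2 * g + 1)).re < -(1 / 4 : ℝ); linarith [not_lt.1 h])

/-- `rho` in complex coordinates. [folklore] -/
theorem rho_mk' (g : ℕ) (a b : ℂ) :
    rho g (mk a b) = ‖b ^ 2 - a ^ (2 * g + 1) - 1‖ ^ 2 + eta (‖a‖ ^ 2) := by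
  simp only [rho, w, Phi, cx_mk, cy_mk]

/-- `w = y² − x^{2g+1} − 1`. [folklore] -/
theorem w_eq' (g : ℕ) (q : 𝔼 4) : w g q = cy q ^ 2 - cx q ^ (2 * g + 1) - 1 := rfl

/-- `y² = x^{2g+1} + 1 + w`. [folklore] -/
theorem cy_sq_eq (g : ℕ) (q : 𝔼 4) : cy q ^ 2 = cx q ^ (2 * g + 1) + 1 + w g q := by
  rw [w_eq']; ring

/-- On the base `‖w‖ ≤ 1/2`. [folklore] -/
theorem norm_w_le (p : Base g) : ‖w g p.1‖ ≤ 1 / 2 := by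
  nlinarith [(bounds_of_rho_le g p.2).2, norm_nonneg (w g p.1)]

/-- `eta` bookkeeping: if `‖a'‖^{n+1} ≤ max 1 ‖a‖^{n+1}` then `eta ‖a'‖² ≤ eta ‖a‖²` (`eta` is
monotone and vanishes below `4`). [folklore] -/
theorem eta_le_of_pow_le {a b : ℝ} (ha : 0 ≤ a) (hb : 0 ≤ b) {n : ℕ}
    (h : a ^ (n + 1) ≤ max 1 (b ^ (n + 1))) : eta (a ^ 2) ≤ eta (b ^ 2) := by
  rcases le_total 1 b with hb1 | hb1
  · rw [max_eq_right (one_le_pow₀ hb1)] at h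
    have hab : a ≤ b := le_of_pow_le_pow_left₀ (Nat.succ_ne_zero n) hb h
    exact eta_monotone (by nlinarith)
  · rw [max_eq_left (pow_le_one₀ hb hb1)] at h
    have ha1 : a ≤ 1 := le_of_pow_le_pow_left₀ (Nat.succ_ne_zero n) zero_le_one (by rwa [one_pow])
    rw [eta_of_le (by nlinarith)]
    exact eta_nonneg _

/-- A convex combination of `1` and `c ≥ 0` is at most `max 1 c`. [folklore] -/
theorem convex_comb_le_max {s c : ℝ} (hs0 : 0 ≤ s) (hs1 : s ≤ 1) :
    (1 - s) + s * c ≤ max 1 c := by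
  rcases le_total 1 c with h | h
  · rw [max_eq_right h]; nlinarith
  · rw [max_eq_left h]; nlinarith

/-- **Staying in the base.**  If `p = (x, y) ∈ Base g` and `(a', b')` has thickening parameter
`b'² − a'^{2g+1} − 1 = t · w(p)` with `0 ≤ t ≤ 1` and `‖a'‖^{2g+1} ≤ max 1 ‖x‖^{2g+1}`, then
`(a', b') ∈ Base g` (`rho = ‖w‖² + eta ‖x‖²` does not increase). [folklore] -/
theorem mk_mem_base (p : Base g) {a' b' : ℂ} {t : ℝ} (ht0 : 0 ≤ t) (ht1 : t ≤ 1)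
    (hw : b' ^ 2 - a' ^ (2 * g + 1) - 1 = (t : ℂ) * w g p.1)
    (ha : ‖a'‖ ^ (2 * g + 1) ≤ max 1 (‖cx p.1‖ ^ (2 * g + 1))) :
    mk a' b' ∈ rho g ⁻¹' Iic (1 / 4 : ℝ) := by
  have hp : rho g p.1 ≤ 1 / 4 := p.2
  rw [mem_preimage, mem_Iic, rho_mk', hw, norm_mul, Complex.norm_real, Real.norm_eq_abs,
    abs_of_nonneg ht0, mul_pow]
  have h1 : t ^ 2 * ‖w g p.1‖ ^ 2 ≤ ‖w g p.1‖ ^ 2 :=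
    mul_le_of_le_one_left (sq_nonneg _) (pow_le_one₀ ht0 ht1)
  have h2 : eta (‖a'‖ ^ 2) ≤ eta (‖cx p.1‖ ^ 2) := eta_le_of_pow_le (norm_nonneg _) (norm_nonneg _) ha
  have h3 : rho g p.1 = ‖w g p.1‖ ^ 2 + eta (‖cx p.1‖ ^ 2) := rfl
  linarith

/-- `‖e^{iπ/n}‖ = 1`. [folklore] -/
theorem norm_halfRoot (n : ℕ) : ‖halfRoot n‖ = 1 := by
  rw [halfRoot, show (Real.pi : ℂ) * Complex.I / n = ((Real.pi / n : ℝ) : ℂ) * Complex.I by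
    push_cast; ring, Complex.norm_exp_ofReal_mul_I]

/-- `‖e^{2πi/n}‖ = 1`. [folklore] -/
theorem norm_rootU (n : ℕ) : ‖rootU n‖ = 1 := by
  rw [rootU, show (2 : ℂ) * Real.pi * Complex.I / n = ((2 * Real.pi / n : ℝ) : ℂ) * Complex.I by
    push_cast; ring, Complex.norm_exp_ofReal_mul_I]

/-- `√1 = 1`. [folklore] -/
@[simp] theorem csqrt_one : csqrt 1 = 1 := Complex.one_cpow _

/-- `√z ≠ 0` for `z ≠ 0`. [folklore] -/
theorem csqrt_ne_zero {z : ℂ} (hz : z ≠ 0) : csqrt z ≠ 0 := fun h => by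
  have := csqrt_sq z; rw [h, zero_pow two_ne_zero] at this; exact hz this.symm

/-- The square root is continuous on the open right half-plane. [folklore] -/
theorem continuousOn_csqrt : ContinuousOn csqrt {z : ℂ | 0 < z.re} := fun _ hz =>
  (continuousAt_csqrt (le_of_lt hz)).continuousWithinAt

/-! ## §9 The piece `U` deformation retracts onto the two points `(0, ±1)` -/

/-- On `U`, `Re y² > 1/8 > 0` (`y² = x^{2g+1} + 1 + w`, `‖w‖ ≤ 1/2`). [folklore] -/
theorem re_cy_sq_gt (p : ↥(coverU g)) : 1 / 8 < (cy p.1.1 ^ 2).re := by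
  have h1 : -(3 / 8 : ℝ) < (cx p.1.1 ^ (2 * g + 1)).re := p.2
  have h2 : |(w g p.1.1).re| ≤ 1 / 2 := (Complex.abs_re_le_norm _).trans (norm_w_le p.1)
  rw [cy_sq_eq g, Complex.add_re, Complex.add_re, Complex.one_re]
  change 1 / 8 < (cx p.1.1 ^ (2 * g + 1)).re + 1 + (w g p.1.1).re
  linarith [neg_abs_le (w g p.1.1).re]

/-- On `U`, `y² ≠ 0`. [folklore] -/
theorem cy_sq_ne_zero (p : ↥(coverU g)) : cy p.1.1 ^ 2 ≠ 0 := fun h => by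
  have := re_cy_sq_gt p; rw [h, Complex.zero_re] at this; linarith

/-- **The sheet sign `angU = y / √(y²) ∈ {±1}` on `U`.** [folklore] -/
def angU (p : ↥(coverU g)) : ℂ := cy p.1.1 / csqrt (cy p.1.1 ^ 2)

/-- `angU² = 1`. [folklore] -/
theorem angU_pow (p : ↥(coverU g)) : angU p ^ 2 = 1 := by
  rw [angU, div_pow, csqrt_sq, div_self (cy_sq_ne_zero p)]

/-- `y = angU · √(y²)` on `U`. [folklore] -/
theorem cy_eq_angU_mul (p : ↥(coverU g)) : cy p.1.1 = angU p * csqrt (cy p.1.1 ^ 2) := by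
  rw [angU, div_mul_cancel₀ _ (csqrt_ne_zero (cy_sq_ne_zero p))]

/-- The sheet sign is continuous. [folklore] -/
theorem continuous_angU : Continuous (angU (g := g)) := by
  have h1 : Continuous fun p : ↥(coverU g) => cy p.1.1 :=
    contDiff_cy.continuous.comp (continuous_subtype_val.comp continuous_subtype_val)
  have h2 : Continuous fun p : ↥(coverU g) => csqrt (cy p.1.1 ^ 2) :=
    continuousOn_csqrt.comp_continuous (h1.pow 2) fun p => lt_trans (by norm_num) (re_cy_sq_gt p)
  exact h1.div h2 fun p => csqrt_ne_zero (cy_sq_ne_zero p)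

/-- **The index map `U → Fin 2`.** [folklore] -/
def idxU : C(↥(coverU g), Fin 2) :=
  ⟨fun p => rootIdx two_ne_zero (angU p), continuous_rootIdx_comp two_ne_zero continuous_angU angU_pow⟩

/-- The index map in closed form: the exponent of the sheet sign `y / √(y²) = (−1)^{idxU}`. [folklore] -/
theorem idxU_apply (p : ↥(coverU g)) : idxU p = rootIdx two_ne_zero (cy p.1.1 / csqrt (cy p.1.1 ^ 2)) := rfl

/-- The base point `(0, μ^k)` (`μ = −1`) lies in the base: `rho = 0`. [folklore] -/
theorem basePtU_mem (g k : ℕ) : mk 0 (rootU 2 ^ k) ∈ rho g ⁻¹' Iic (1 / 4 : ℝ) := by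
  rw [mem_preimage, mem_Iic, rho_mk', rootU_pow_pow two_ne_zero, zero_pow (Nat.succ_ne_zero _),
    norm_zero, zero_pow two_ne_zero, eta_of_le (by norm_num)]
  norm_num

/-- The base points lie in `U` (`x = 0`). [folklore] -/
theorem basePtU_mem_coverU (g k : ℕ) : (⟨mk 0 (rootU 2 ^ k), basePtU_mem g k⟩ : Base g) ∈ coverU g := by
  show -(3 / 8 : ℝ) < (cx (mk 0 (rootU 2 ^ k)) ^ (2 * g + 1)).re
  rw [cx_mk, zero_pow (Nat.succ_ne_zero _), Complex.zero_re]; norm_num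

/-- **The section `Fin 2 → U`**, `k ↦ (0, μ^k)`. [folklore] -/
def secU (g : ℕ) : C(Fin 2, ↥(coverU g)) :=
  ⟨fun k => ⟨⟨mk 0 (rootU 2 ^ (k : ℕ)), basePtU_mem g k⟩, basePtU_mem_coverU g k⟩,
    continuous_of_discreteTopology⟩

/-- `idx ∘ sec = id` on `U`. [folklore] -/
theorem idxU_secU (k : Fin 2) : idxU (secU g k) = k := by
  show rootIdx two_ne_zero (angU (secU g k)) = k
  have h : angU (secU g k) = rootU 2 ^ (k : ℕ) := by
    rw [angU]
    show cy (mk 0 _) / csqrt (cy (mk 0 _) ^ 2) = _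
    rw [cy_mk, rootU_pow_pow two_ne_zero, csqrt_one, div_one]
  rw [h, rootIdx_rootU_pow]

/-- **The deformation of `U`**: `(x, y) ↦ (t x, angU · √((tx)^{2g+1} + 1 + t w))`. [cite: Milnor1968, §9 Lemma 9.2] -/
def defU (t : ℝ) (p : ↥(coverU g)) : 𝔼 4 :=
  mk ((t : ℂ) * cx p.1.1) (angU p * csqrt (((t : ℂ) * cx p.1.1) ^ (2 * g + 1) + 1 + (t : ℂ) * w g p.1.1))

/-- Along the deformation `Re (tx)^{2g+1} > −3/8`. [folklore] -/
theorem re_tx_pow_gt {t : ℝ} (ht0 : 0 ≤ t) (ht1 : t ≤ 1) (p : ↥(coverU g)) :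
    -(3 / 8 : ℝ) < (((t : ℂ) * cx p.1.1) ^ (2 * g + 1)).re := by
  have hU : -(3 / 8 : ℝ) < (cx p.1.1 ^ (2 * g + 1)).re := p.2
  have ht : 0 ≤ t ^ (2 * g + 1) := pow_nonneg ht0 _
  have ht' : t ^ (2 * g + 1) ≤ 1 := pow_le_one₀ ht0 ht1
  rw [mul_pow, ← Complex.ofReal_pow, Complex.re_ofReal_mul]
  change -(3 / 8 : ℝ) < t ^ (2 * g + 1) * (cx p.1.1 ^ (2 * g + 1)).re
  rcases le_or_gt 0 (cx p.1.1 ^ (2 * g + 1)).re with h | h <;> nlinarith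

/-- Along the deformation the radicand has `Re > 1/8`. [folklore] -/
theorem re_radU_gt {t : ℝ} (ht0 : 0 ≤ t) (ht1 : t ≤ 1) (p : ↥(coverU g)) :
    1 / 8 < (((t : ℂ) * cx p.1.1) ^ (2 * g + 1) + 1 + (t : ℂ) * w g p.1.1).re := by
  have h1 := re_tx_pow_gt ht0 ht1 p
  have h2 : |(w g p.1.1).re| ≤ 1 / 2 := (Complex.abs_re_le_norm _).trans (norm_w_le p.1)
  rw [Complex.add_re, Complex.add_re, Complex.one_re, Complex.re_ofReal_mul]
  have h3 : -(1 / 2 : ℝ) ≤ t * (w g p.1.1).re := by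
    rcases le_or_gt 0 (w g p.1.1).re with h | h
    · nlinarith
    · nlinarith [neg_abs_le (w g p.1.1).re]
  linarith

/-- The deformation stays in the base. [folklore] -/
theorem defU_mem {t : ℝ} (ht0 : 0 ≤ t) (ht1 : t ≤ 1) (p : ↥(coverU g)) :
    defU t p ∈ rho g ⁻¹' Iic (1 / 4 : ℝ) := by
  refine mk_mem_base p.1 ht0 ht1 ?_ ?_
  · rw [mul_pow, angU_pow, one_mul, csqrt_sq]; ring
  · rw [norm_mul, Complex.norm_real, Real.norm_eq_abs, abs_of_nonneg ht0, mul_pow]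
    exact (mul_le_of_le_one_left (pow_nonneg (norm_nonneg _) _) (pow_le_one₀ ht0 ht1)).trans
      (le_max_right _ _)

/-- The deformation stays in `U`. [folklore] -/
theorem defU_mem_coverU {t : ℝ} (ht0 : 0 ≤ t) (ht1 : t ≤ 1) (p : ↥(coverU g)) :
    (⟨defU t p, defU_mem ht0 ht1 p⟩ : Base g) ∈ coverU g := by
  show -(3 / 8 : ℝ) < (cx (defU t p) ^ (2 * g + 1)).re
  rw [defU, cx_mk]
  exact re_tx_pow_gt ht0 ht1 p

/-- The deformation as a map `[0,1] × U → U`. [folklore] -/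
def defUMap (z : unitInterval × ↥(coverU g)) : ↥(coverU g) :=
  ⟨⟨defU z.1 z.2, defU_mem z.1.2.1 z.1.2.2 z.2⟩, defU_mem_coverU z.1.2.1 z.1.2.2 z.2⟩

/-- The deformation is continuous. [folklore] -/
theorem continuous_defUMap : Continuous (defUMap (g := g)) := by
  refine Continuous.subtype_mk (Continuous.subtype_mk ?_ _) _
  have hs : Continuous fun z : unitInterval × ↥(coverU g) => ((z.1 : ℝ) : ℂ) :=
    Complex.continuous_ofReal.comp (continuous_subtype_val.comp continuous_fst)
  have hx : Continuous fun z : unitInterval × ↥(coverU g) => cx z.2.1.1 :=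
    contDiff_cx.continuous.comp (continuous_subtype_val.comp (continuous_subtype_val.comp continuous_snd))
  have hw : Continuous fun z : unitInterval × ↥(coverU g) => w g z.2.1.1 :=
    (contDiff_w g).continuous.comp (continuous_subtype_val.comp (continuous_subtype_val.comp continuous_snd))
  have hrad : Continuous fun z : unitInterval × ↥(coverU g) =>
      (((z.1 : ℝ) : ℂ) * cx z.2.1.1) ^ (2 * g + 1) + 1 + ((z.1 : ℝ) : ℂ) * w g z.2.1.1 :=
    (((hs.mul hx).pow _).add continuous_const).add (hs.mul hw)
  have hroot : Continuous fun z : unitInterval × ↥(coverU g) =>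
      csqrt ((((z.1 : ℝ) : ℂ) * cx z.2.1.1) ^ (2 * g + 1) + 1 + ((z.1 : ℝ) : ℂ) * w g z.2.1.1) :=
    continuousOn_csqrt.comp_continuous hrad fun z => lt_trans (by norm_num) (re_radU_gt z.1.2.1 z.1.2.2 z.2)
  have hang : Continuous fun z : unitInterval × ↥(coverU g) => angU z.2 := continuous_angU.comp continuous_snd
  exact continuous_mk.comp ((hs.mul hx).prodMk (hang.mul hroot))

/-- At `t = 1` the deformation is the identity. [folklore] -/
theorem defU_one (p : ↥(coverU g)) : defU 1 p = p.1.1 := by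
  rw [defU, Complex.ofReal_one, one_mul, one_mul, ← cy_sq_eq, ← cy_eq_angU_mul, mk_cx_cy]

/-- At `t = 0` the deformation is the base point `sec (idx p)`. [folklore] -/
theorem defU_zero (p : ↥(coverU g)) : defU 0 p = (secU g (idxU p)).1.1 := by
  rw [defU, Complex.ofReal_zero, zero_mul, zero_mul, zero_pow (Nat.succ_ne_zero _), zero_add, add_zero,
    csqrt_one, mul_one]
  show mk 0 (angU p) = mk 0 (rootU 2 ^ (rootIdx two_ne_zero (angU p) : ℕ))
  rw [rootU_pow_rootIdx two_ne_zero (angU_pow p)]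

/-- **The homotopy `id_U ≃ sec ∘ idx`.** [cite: Milnor1968, §9 Lemma 9.2] -/
def homotopyU (g : ℕ) : ContinuousMap.Homotopy (ContinuousMap.id ↥(coverU g)) ((secU g).comp idxU) where
  toFun z := defUMap (unitInterval.symm z.1, z.2)
  continuous_toFun := continuous_defUMap.comp
    ((unitInterval.continuous_symm.comp continuous_fst).prodMk continuous_snd)
  map_zero_left p := by
    apply Subtype.ext; apply Subtype.ext
    show defU (unitInterval.symm 0 : ℝ) p = p.1.1
    rw [unitInterval.symm_zero, Set.Icc.coe_one, defU_one]
  map_one_left p := by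
    apply Subtype.ext; apply Subtype.ext
    show defU (unitInterval.symm 1 : ℝ) p = (secU g (idxU p)).1.1
    rw [unitInterval.symm_one, Set.Icc.coe_zero, defU_zero]

/-- **`U ≃ Fin 2`**: the piece `U` of the base is homotopy equivalent to two points (its two
`y`-sheets). [cite: Milnor1968, §9 Lemma 9.2] -/
def homotopyEquivU (g : ℕ) : ContinuousMap.HomotopyEquiv ↥(coverU g) (Fin 2) where
  toFun := idxU
  invFun := secU g
  left_inv := ⟨(homotopyU g).symm⟩
  right_inv := by
    rw [show idxU.comp (secU g) = ContinuousMap.id (Fin 2) from ContinuousMap.ext idxU_secU]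

end LefschetzBase

end Literature.Topology.FourManifolds
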